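import Literature.IUT.LogVolume.SubThetaFieldRamificationBound
import Literature.NumberTheory.EllipticCurves.DivisionFieldRamificationPotMultProofs
import Literature.IUT.LogVolume.Corollary22TateInput
import Literature.IUT.LogVolume.HeightDivisor
import Literature.IUT.LogVolume.Corollary22PartIILemmas
import HarnessLib

/-!
# The ramification of a field pinned by the v3 Θ-datum DIVIDES `60` at every BAD place away from `2·3·5`
# (the `F/F_tpd` layer of the «LOCAL-TYPE LEMMA» of the abc-iut R-W window table; proof-only)

Mochizuki, *Inter-universal Teichmüller theory IV* (RIMS manuscript Apr. 2020 = PRIMS **57** (2021)), Thm. 1.10,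
Step (ii) p. 24 ("`Gal(F/F_tpd) ↪ GL₂(𝔽₃) × GL₂(𝔽₅) × ℤ/2ℤ`") and Step (iii) (R2)–(R4) p. 25–26 (the per-place
ramification budget of the layer `F/F_tpd`); J.-P. Serre, *Propriétés galoisiennes des points d'ordre fini des courbes
elliptiques*, Invent. Math. **15** (1972), §1.11–§1.12 (at a place of potentially multiplicative reduction the
inertia group acts on `E[p]`, `p ≠` residue characteristic, through `(1 *; 0 1)` up to the quadratic twist
character, so its image has order dividing `2p`).

In the cell's MODEL READING v3 the field of a genuine Θ-volume datum is pinned by `Cor22.IsSubThetaField P F`: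
`F ⊆ F‡(P) = F_tpd(√−1, √λ, √(λ−1), E_λ[3·5])`. abc-iut-S1's `Cor22.ramificationIdx_subThetaField_le`
(`SubThetaFieldRamificationBound.lean`) bounds `e(w | v) ≤ 46080 = 2·|GL₂(𝔽₃)|·|GL₂(𝔽₅)|` at every odd place.
THIS FILE sharpens the bound to a DIVISIBILITY at the BAD places of `λ` (`ord_v j(λ) < 0`, i.e. `E_λ` potentially
multiplicative at `v`) of residue characteristic `∉ {2, 3, 5}`:

* `WeierstrassCurve.natCard_map_galoisRepTorsion_dvd_of_forall_pow_eq_one` — for an elliptic curve `W` over a number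
  field and a subgroup `J ≤ Γ_K` on which `ρ̄_{W,p}(σ)^p = 1` (`p` prime), the image `ρ̄_{W,p}(J) ≤ Aut(W[p])` has
  order dividing `p` (a group of exponent `p` inside a group of order `(p²−1)(p²−p)`);
* `Cor22.relIndex_sqrtFixer_dvd_two`, `Cor22.relIndex_sqrtFixer_inf_dvd_two` — divisibility forms of abc-iut-S1's
  `relIndex_sqrtFixer_le_two` / `relIndex_sqrtFixer_inf_le_two`;
* **`Cor22.ramificationIdx_subThetaField_dvd_sixty`** — for `P ∈ U`, `F` Galois over `F_tpd` with
  `IsSubThetaField P F`, and a place `w` of `F` over a BAD place `v` of `λ` with `v ∤ 30`: **`e(w | v) ∣ 60`**.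
  PROOF (inertia level, as in abc-iut-S1's file, with abc-iut-L5-t12's unipotence step
  `galoisRepTorsion_pow_eq_one_of_mem_inertia_of_hasMultiplicativeReductionAt_quadraticTwist` inserted): the absolute
  inertia group `I = I_𝔓` at `v` fixes `√−1` and the even-order twist root `√c`, `c ∈ {λ, λ−1, λ(λ−1)}`; some
  quadratic twist `E_λ^{(d)}` has multiplicative reduction at `v` (`ord_v j < 0`, the tree's
  `exists_hasMultiplicativeReductionAt_quadraticTwist_of_one_lt_valuation_j`), and on `I ∩ Γ_{F_tpd(√d)}` (index
  `∣ 2` in `I`) the representations `ρ̄₃`, `ρ̄₅` have exponent `3`, `5`, hence images of order `∣ 3`, `∣ 5`; the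
  remaining twist fixer has index `∣ 2`. So `[I : I ∩ H] ∣ 2·3·5·2 = 60` for the generator-fixer
  `H = ker ρ̄₃ ∩ ker ρ̄₅ ∩ sqrtFixer(−1) ∩ sqrtFixer(λ) ∩ sqrtFixer(λ−1) ≤ Gal(F̄_tpd/F)`, and `e(w | v) = #I_w(Gal(F/F_tpd))`
  (Mathlib `Ideal.card_inertia_eq_ramificationIdxIn` via the tree's `ramificationIdx_eq_card_inertia_comap`) is the
  order of the restriction of `I`, which divides `[I : I ∩ H]`.

With abc-iut-L5-t12's / the tree's `e(u | w) ∣ l` for the `l`-division layer `K/F` at multiplicative places this gives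
the LOCAL TYPE `e(K_u/ℚ_p) ∣ 60·l·e(v|p)` of the abc-iut R-W window table (rw-num-lead F1-4; `GenuineTowerLocalType.lean`).
Proof-only (no definition, no named fact); classical algebraic number theory; TAKES NO SIDE on [IUTchIII] Cor. 3.12.
-/

noncomputable section

open scoped Classical

/-! ## A group of exponent `p` inside `Aut(E[p])` has order dividing `p` -/

namespace WeierstrassCurve

open NumberField Field Literature.NumberTheory.EllipticCurves Literature.NumberTheory.GaloisRepresentations

variable {K : Type} [Field K] [NumberField K] (W : WeierstrassCurve K)

/-- If `p` is prime and `p^k ∣ (p² − 1)(p² − p) = #GL₂(𝔽_p)`, then `p^k ∣ p` (the `p`-part of `#GL₂(𝔽_p)` is `p`;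
the tree's sibling files keep this private, so it is re-derived here). [folklore] -/
private theorem pow_dvd_of_pow_dvd_card_GL_two {p k : ℕ} (hp : p.Prime)
    (h : p ^ k ∣ (p ^ 2 - 1) * (p ^ 2 - p)) : p ^ k ∣ p := by
  have hfac : (p ^ 2 - 1) * (p ^ 2 - p) = p * ((p - 1) * (p + 1) * (p - 1)) := by
    have h1 : p ^ 2 - 1 = (p - 1) * (p + 1) := by
      rw [mul_comm, ← Nat.sq_sub_sq, one_pow]
    have h2 : p ^ 2 - p = p * (p - 1) := by
      rw [Nat.mul_sub, mul_one, sq]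
    rw [h1, h2]; ring
  rw [hfac] at h
  have hcop1 : Nat.Coprime p (p - 1) := by
    refine (Nat.Prime.coprime_iff_not_dvd hp).mpr fun hd => ?_
    have hlt : p - 1 < p := Nat.sub_lt hp.pos one_pos
    have hpos : 0 < p - 1 := Nat.sub_pos_of_lt hp.one_lt
    exact absurd (Nat.le_of_dvd hpos hd) (not_le.mpr hlt)
  have hcop2 : Nat.Coprime p (p + 1) := by
    refine (Nat.Prime.coprime_iff_not_dvd hp).mpr fun hd => ?_
    have : p ∣ 1 := (Nat.dvd_add_right (dvd_refl p)).mp hd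
    exact hp.one_lt.ne' (Nat.dvd_one.mp this)
  have hcop : Nat.Coprime (p ^ k) ((p - 1) * (p + 1) * (p - 1)) :=
    Nat.Coprime.pow_left k ((hcop1.mul_right hcop2).mul_right hcop1)
  exact hcop.dvd_of_dvd_mul_right h

/-- **A subgroup of `Γ_K` on which `ρ̄_{W,p}` has exponent `p` has image of order dividing `p`.** For an elliptic
curve `W` over a number field `K`, a prime `p` and a subgroup `J ≤ Γ_K` with `ρ̄_{W,p}(σ)^p = 1` for all `σ ∈ J`,
the image `ρ̄_{W,p}(J) ≤ Aut(W[p])` is a `p`-group (Cauchy), and `#Aut(W[p]) = (p² − 1)(p² − p)` (the tree's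
`natCard_addAut_geomTorsion`) has `p`-part `p`. [cite: Serre1972, §1.11–§1.12] -/
theorem natCard_map_galoisRepTorsion_dvd_of_forall_pow_eq_one [W.IsElliptic] {p : ℕ} (hp : p.Prime)
    (J : Subgroup (absoluteGaloisGroup K)) (hJ : ∀ σ ∈ J, W.galoisRepTorsion (p : ℤ) σ ^ p = 1) :
    Nat.card (J.map (W.galoisRepTorsion (p : ℤ))) ∣ p := by
  haveI : Fact p.Prime := ⟨hp⟩
  have hM : Nat.card (Multiplicative (AddAut (W.geomTorsion (p : ℤ)))) = (p ^ 2 - 1) * (p ^ 2 - p) := by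
    rw [show Nat.card (Multiplicative (AddAut (W.geomTorsion (p : ℤ)))) = Nat.card (AddAut (W.geomTorsion (p : ℤ)))
      from Nat.card_congr Multiplicative.toAdd, W.natCard_addAut_geomTorsion hp]
  have hM0 : Nat.card (Multiplicative (AddAut (W.geomTorsion (p : ℤ)))) ≠ 0 := by
    rw [hM]
    have h2 := hp.two_le
    have h1 : 1 < p ^ 2 := Nat.one_lt_pow two_ne_zero hp.one_lt
    have h3 : p < p ^ 2 := by nlinarith
    exact Nat.mul_ne_zero (Nat.sub_ne_zero_of_lt h1) (Nat.sub_ne_zero_of_lt h3)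
  haveI : Finite (Multiplicative (AddAut (W.geomTorsion (p : ℤ)))) := Nat.finite_of_card_ne_zero hM0
  set U : Subgroup (Multiplicative (AddAut (W.geomTorsion (p : ℤ)))) := J.map (W.galoisRepTorsion (p : ℤ)) with hU
  have hpg : IsPGroup p U := by
    intro g
    refine ⟨1, ?_⟩
    obtain ⟨σ, hσ, hσg⟩ := Subgroup.mem_map.mp g.2
    rw [pow_one, ← Subtype.coe_inj, Subgroup.coe_pow, Subgroup.coe_one, ← hσg]
    exact hJ σ hσ
  obtain ⟨n, hn⟩ := IsPGroup.iff_card.mp hpg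
  have hdvd : Nat.card U ∣ (p ^ 2 - 1) * (p ^ 2 - p) := hM ▸ Subgroup.card_subgroup_dvd_card U
  rw [hn] at hdvd ⊢
  exact pow_dvd_of_pow_dvd_card_GL_two hp hdvd

end WeierstrassCurve

namespace Literature.IUT.LogVolume

namespace Cor22

open NumberField IsDedekindDomain Literature.NumberTheory.DiophantineGeometry.GenEll
open Literature.NumberTheory.EllipticCurves Literature.NumberTheory.GaloisRepresentations
open Literature.NumberTheory.NumberFields WeierstrassCurve IntermediateField Field

variable (P : NFPoint)

/-! ## Square-root fixers: divisibility forms of the index-`2` bounds -/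

/-- `sqrtFixer a` has relative index DIVIDING `2` in any subgroup `A` (it is normal of index `∣ 2`).
[cite: MilneFT2022, Ch. 5 (Kummer theory: the polynomial X² − a)] -/
theorem relIndex_sqrtFixer_dvd_two (a : P.F) (A : Subgroup (absoluteGaloisGroup P.F)) :
    (sqrtFixer P a).relIndex A ∣ 2 := by
  haveI : IsGalois P.F (adjoin P.F {z : AlgebraicClosure P.F | z ^ 2 = algebraMap P.F _ a}) := isGalois_adjoin_sqrtSet _
  haveI : (sqrtFixer P a).Normal := IsGalois.fixingSubgroup_normal_of_isGalois _
  exact (Subgroup.relIndex_dvd_index_of_normal (sqrtFixer P a) A).trans (index_fixingSubgroup_adjoin_sqrtSet_dvd_two a)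

/-- **The pair of twist fixers has relative index DIVIDING `2` in any `A ≤ sqrtFixer c`, `c ∈ {λ, λ−1, λ(λ−1)}`**
(`λ ≠ 0`; divisibility form of abc-iut-S1's `relIndex_sqrtFixer_inf_le_two`).
[cite: Mochizuki2012, IUTchIV Thm 1.10 proof Step (ii) p.24] -/
theorem relIndex_sqrtFixer_inf_dvd_two (hx : P.x ≠ 0) {c : P.F}
    (hc : c ∈ ({P.x, P.x - 1, P.x * (P.x - 1)} : Set P.F)) (A : Subgroup (absoluteGaloisGroup P.F))
    (hA : A ≤ sqrtFixer P c) :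
    (sqrtFixer P P.x ⊓ sqrtFixer P (P.x - 1)).relIndex A ∣ 2 := by
  have hle := relIndex_sqrtFixer_inf_le_two P hx hc A hA
  have hne : (sqrtFixer P P.x ⊓ sqrtFixer P (P.x - 1)).relIndex A ≠ 0 := by
    refine Subgroup.relIndex_inf_ne_zero ?_ ?_
    · intro h0
      have h := relIndex_sqrtFixer_dvd_two P P.x A
      rw [h0] at h
      exact absurd (zero_dvd_iff.mp h) two_ne_zero
    · intro h0
      have h := relIndex_sqrtFixer_dvd_two P (P.x - 1) A
      rw [h0] at h
      exact absurd (zero_dvd_iff.mp h) two_ne_zero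
  generalize (sqrtFixer P P.x ⊓ sqrtFixer P (P.x - 1)).relIndex A = n at hle hne ⊢
  interval_cases n
  · exact absurd rfl hne
  · exact one_dvd 2
  · exact dvd_refl 2

/-! ## The divisibility `e(w | v) ∣ 60` at the bad places away from `2·3·5` -/

variable {P} (F : Type) [Field F] [NumberField F] [Algebra P.F F]

/-- **`e(w | v) ∣ 60` for every place `w` of a field pinned by `IsSubThetaField P F` (Galois over `F_tpd`) over a
BAD place `v ∤ 2·3·5` of `λ`** (`ord_v j(λ) < 0`). The absolute inertia group `I` at `v` fixes `√−1` and the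
even-order twist root; some quadratic twist of the Legendre curve `E_λ` has multiplicative reduction at `v`, so on
`I ∩ Γ_{F_tpd(√d)}` (index `∣ 2`) the images of `ρ̄_{E_λ,3}`, `ρ̄_{E_λ,5}` have orders `∣ 3`, `∣ 5` (unipotence of
inertia, Serre 1972 §1.12; the tree's
`galoisRepTorsion_pow_eq_one_of_mem_inertia_of_hasMultiplicativeReductionAt_quadraticTwist`), and the remaining twist
fixer has index `∣ 2`: `e(w|v) ∣ [I : I ∩ ker ρ̄₃ ∩ ker ρ̄₅ ∩ fixers] ∣ 2·3·5·2`.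
[cite: Serre1972, §1.11–§1.12] [cite: Mochizuki2012, IUTchIV Thm 1.10 proof Step (iii) (R2)–(R4) p.25–26] -/
theorem ramificationIdx_subThetaField_dvd_sixty (hU : P.InU) (hF : IsSubThetaField P F) [IsGalois P.F F]
    (w : HeightOneSpectrum (𝓞 F)) (hbad : finBelow P.F F w ∈ badPlaces P)
    (h30 : ((30 : ℕ) : 𝓞 P.F) ∉ (finBelow P.F F w).asIdeal) :
    w.asIdeal.ramificationIdx (𝓞 P.F) ∣ 60 := by
  haveI : P.legendreCurve.IsElliptic := P.legendreCurve_isElliptic_iff.2 hU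
  haveI : Fact (Nat.Prime 3) := ⟨Nat.prime_three⟩
  haveI : Fact (Nat.Prime 5) := ⟨Nat.prime_five⟩
  set v := finBelow P.F F w with hvdef
  haveI := v.isPrime
  -- residue characteristic `∉ {2, 3, 5}`
  have h2 : ((2 : ℕ) : 𝓞 P.F) ∉ v.asIdeal := fun h => h30 (by
    rw [show (30 : ℕ) = 15 * 2 from rfl, Nat.cast_mul]; exact Ideal.mul_mem_left _ _ h)
  have h3 : ((3 : ℕ) : 𝓞 P.F) ∉ v.asIdeal := fun h => h30 (by
    rw [show (30 : ℕ) = 10 * 3 from rfl, Nat.cast_mul]; exact Ideal.mul_mem_left _ _ h)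
  have h5 : ((5 : ℕ) : 𝓞 P.F) ∉ v.asIdeal := fun h => h30 (by
    rw [show (30 : ℕ) = 6 * 5 from rfl, Nat.cast_mul]; exact Ideal.mul_mem_left _ _ h)
  have h2' : (2 : 𝓞 P.F) ∉ v.asIdeal := by exact_mod_cast h2
  -- `F ≃ L := F_tpd(φ S) ⊆ F̄_tpd`
  haveI : FiniteDimensional P.F F := Module.Finite.of_restrictScalars_finite ℚ P.F F
  set Ω := AlgebraicClosure P.F
  let φ : F →ₐ[P.F] Ω := IsAlgClosed.lift
  set S : Set F := subThetaFieldGenerators P F with hSdef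
  set L : IntermediateField P.F Ω := IntermediateField.adjoin P.F (φ '' S) with hLdef
  have hL : φ.fieldRange = L := by
    rw [AlgHom.fieldRange_eq_map, ← hF.adjoin_eq_top, IntermediateField.adjoin_map]
  let e : F ≃ₐ[P.F] L :=
    (((IntermediateField.topEquiv (F := P.F) (E := F)).symm.trans (IntermediateField.equivMap ⊤ φ)).trans
      (IntermediateField.equivOfEq (AlgHom.fieldRange_eq_map φ).symm)).trans
      (IntermediateField.equivOfEq hL)
  haveI : FiniteDimensional P.F L := LinearEquiv.finiteDimensional e.toLinearEquiv
  haveI : IsGalois P.F L := IsGalois.of_algEquiv e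
  haveI : NumberField L := NumberField.of_module_finite P.F L
  -- absolute inertia at `v`
  obtain ⟨𝔓, h𝔓⟩ := HeightOneSpectrum.primesAbove_nonempty v
  haveI : 𝔓.IsPrime := h𝔓.1
  haveI : 𝔓.LiesOver v.asIdeal := h𝔓.2
  set I : Subgroup (absoluteGaloisGroup P.F) := 𝔓.inertia (absoluteGaloisGroup P.F) with hIdef
  -- the even-order twist radicand `c` at `v`
  obtain ⟨c, hc, k, hck⟩ := exists_valuation_eq_exp_two_mul v hU.1
  have h4 : ((4 : ℕ) : 𝓞 P.F) ∉ v.asIdeal := by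
    intro h
    have : ((2 : ℕ) : 𝓞 P.F) * ((2 : ℕ) : 𝓞 P.F) ∈ v.asIdeal := by
      rw [← Nat.cast_mul]; exact h
    rcases (Ideal.IsPrime.mem_or_mem inferInstance this) with h' | h' <;> exact h2 h'
  -- (1) `I ≤ A := sqrtFixer(−1) ⊓ sqrtFixer(c)`
  set A : Subgroup (absoluteGaloisGroup P.F) := sqrtFixer P (-1) ⊓ sqrtFixer P c with hAdef
  have hIA : I ≤ A := by
    intro σ hσ
    refine ⟨mem_fixingSubgroup_adjoin_of_forall_eq (σ := Field.absoluteGaloisGroup.toAlgEquiv P.F σ)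
        fun z hz => ?_,
      mem_fixingSubgroup_adjoin_of_forall_eq (σ := Field.absoluteGaloisGroup.toAlgEquiv P.F σ) fun z hz => ?_⟩
    · -- `z² = −1`: `z⁴ = 1`
      have hz : z ^ 2 = algebraMap P.F Ω (-1) := hz
      have hz4 : z ^ 4 = 1 := by
        rw [show (4 : ℕ) = 2 * 2 by norm_num, pow_mul, hz, map_neg, map_one]; norm_num
      exact smul_eq_of_mem_inertia_of_pow_eq_one v h𝔓 hσ h4 hz4
    · -- `z² = c`, `c` of even `v`-order
      exact smul_eq_of_mem_inertia_of_sq_eq_of_valuation_eq_exp_even v h𝔓 hσ h2' hck hz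
  -- (2) a multiplicative quadratic twist of `E_λ` at the bad place `v`
  have hord : ord P.F v (jInv P.x) < 0 := (mem_badPlaces_iff_ord_neg P v).1 hbad
  have hj0 : jInv P.x ≠ 0 := fun h0 => by
    rw [h0, ord_zero] at hord
    exact lt_irrefl _ hord
  have hj : 1 < v.valuation P.F P.legendreCurve.j := by
    have hjl : P.legendreCurve.j = jInv P.x := j_legendre P hU
    rw [hjl]
    exact (ord_neg_iff_one_lt_valuation P.F v hj0).1 hord
  obtain ⟨d, hd, hmult⟩ := P.legendreCurve.exists_hasMultiplicativeReductionAt_quadraticTwist_of_one_lt_valuation_j v hj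
  set N : Subgroup (absoluteGaloisGroup P.F) := MulAction.stabilizer (absoluteGaloisGroup P.F) (geomSqrt d) with hNdef
  haveI hNn : N.Normal := stabilizer_geomSqrt_normal d
  have hN2 : N.index ∣ 2 := by
    rcases index_stabilizer_geomSqrt (K := P.F) d with h | h
    · rw [hNdef, h]; exact one_dvd 2
    · rw [hNdef, h]
  -- unipotence of `I ∩ N` on `E_λ[3]`, `E_λ[5]`
  have hunip : ∀ {p : ℕ}, p.Prime → ((p : ℕ) : 𝓞 P.F) ∉ v.asIdeal →
      ∀ σ ∈ N ⊓ I, P.legendreCurve.galoisRepTorsion (p : ℤ) σ ^ p = 1 := by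
    intro p hp hpv σ hσ
    exact P.legendreCurve.galoisRepTorsion_pow_eq_one_of_mem_inertia_of_hasMultiplicativeReductionAt_quadraticTwist
      hp hd hmult hpv h𝔓 hσ.2 hσ.1
  -- (3) the gens-fixer `H ≤ Gal(F̄_tpd/L)`
  set K3 : Subgroup (absoluteGaloisGroup P.F) := (P.legendreCurve.galoisRepTorsion ((3 : ℕ) : ℤ)).ker with hK3
  set K5 : Subgroup (absoluteGaloisGroup P.F) := (P.legendreCurve.galoisRepTorsion ((5 : ℕ) : ℤ)).ker with hK5
  set H : Subgroup (absoluteGaloisGroup P.F) :=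
    K3 ⊓ K5 ⊓ (sqrtFixer P (-1) ⊓ (sqrtFixer P P.x ⊓ sqrtFixer P (P.x - 1))) with hHdef
  have hHN : H ≤ L.fixingSubgroup := by
    intro τ hτ
    refine mem_fixingSubgroup_adjoin_of_forall_eq (σ := Field.absoluteGaloisGroup.toAlgEquiv P.F τ) fun s hs => ?_
    obtain ⟨x, hx, rfl⟩ := hs
    rcases hx with (hsq | hsq | hsq) | htor
    · -- `x² = −1`
      have : (φ x) ^ 2 = algebraMap P.F Ω (-1) := by rw [← map_pow, hsq, map_neg, map_one, map_neg, map_one]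
      exact forall_eq_of_mem_fixingSubgroup_adjoin hτ.2.1 _ this
    · -- `x² = λ`
      have : (φ x) ^ 2 = algebraMap P.F Ω P.x := by rw [← map_pow, hsq, φ.commutes]
      exact forall_eq_of_mem_fixingSubgroup_adjoin hτ.2.2.1 _ this
    · -- `x² = λ − 1`
      have : (φ x) ^ 2 = algebraMap P.F Ω (P.x - 1) := by
        rw [← map_pow, hsq, map_sub, map_one, φ.commutes, map_sub, map_one]
      exact forall_eq_of_mem_fixingSubgroup_adjoin hτ.2.2.2 _ this
    · -- a `15`-torsion coordinate: transport the point to `E_λ(F̄_tpd)`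
      rw [torsionCoords_eq] at htor
      obtain ⟨T, hT, hxT⟩ := Set.mem_iUnion₂.1 htor
      have hT15 : (15 : ℤ) • T = 0 := hT
      let T' : geomPoints P.legendreCurve := Affine.Point.map (W' := P.legendreCurve.toAffine) φ T
      have hT' : (15 : ℤ) • T' = 0 := by
        change (15 : ℤ) • Affine.Point.map (W' := P.legendreCurve.toAffine) φ T = 0
        rw [← map_zsmul, hT15, map_zero]
      have h3' : ∀ Q : geomTorsion P.legendreCurve ((3 : ℕ) : ℤ), τ • Q = Q := by
        intro Q
        have hQ := galoisRepTorsion_apply P.legendreCurve ((3 : ℕ) : ℤ) τ Q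
        rw [(MonoidHom.mem_ker).1 hτ.1.1] at hQ
        exact hQ.symm
      have h5' : ∀ Q : geomTorsion P.legendreCurve ((5 : ℕ) : ℤ), τ • Q = Q := by
        intro Q
        have hQ := galoisRepTorsion_apply P.legendreCurve ((5 : ℕ) : ℤ) τ Q
        rw [(MonoidHom.mem_ker).1 hτ.1.2] at hQ
        exact hQ.symm
      have hfix : τ • T' = T' := smul_eq_of_fifteen τ h3' h5' T' hT'
      refine forall_coords_of_smul_eq P τ T' hfix (φ x) ?_
      rcases T with _ | ⟨a, b, hab⟩
      · simp [pointCoords] at hxT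
      · change φ x ∈ pointCoords (Affine.Point.map (W' := P.legendreCurve.toAffine) φ
          (Affine.Point.some a b hab))
        rw [Affine.Point.map_some]
        simp only [pointCoords, Set.mem_insert_iff, Set.mem_singleton_iff] at hxT ⊢
        rcases hxT with rfl | rfl
        · exact Or.inl rfl
        · exact Or.inr rfl
  -- (4) index bookkeeping along the chain `I ≥ N ⊓ I ≥ K3 ⊓ (N ⊓ I) ≥ K5 ⊓ (K3 ⊓ (N ⊓ I)) ≥ …`: `[I : I ∩ G] ∣ 2·3·5·2`
  set Sx : Subgroup (absoluteGaloisGroup P.F) := sqrtFixer P P.x ⊓ sqrtFixer P (P.x - 1) with hSx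
  have hN : N.relIndex I ∣ 2 := (Subgroup.relIndex_dvd_index_of_normal N I).trans hN2
  have hK3r : K3.relIndex (N ⊓ I) ∣ 3 := by
    rw [hK3, Subgroup.relIndex_ker]
    exact P.legendreCurve.natCard_map_galoisRepTorsion_dvd_of_forall_pow_eq_one Nat.prime_three (N ⊓ I)
      (hunip Nat.prime_three h3)
  have hK5r : K5.relIndex (K3 ⊓ (N ⊓ I)) ∣ 5 := by
    rw [hK5, Subgroup.relIndex_ker]
    exact P.legendreCurve.natCard_map_galoisRepTorsion_dvd_of_forall_pow_eq_one Nat.prime_five (K3 ⊓ (N ⊓ I))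
      (fun σ hσ => hunip Nat.prime_five h5 σ hσ.2)
  have hSxr : Sx.relIndex (K5 ⊓ (K3 ⊓ (N ⊓ I))) ∣ 2 :=
    relIndex_sqrtFixer_inf_dvd_two P hU.1 hc _
      ((inf_le_right.trans (inf_le_right.trans inf_le_right)).trans (hIA.trans inf_le_right))
  have hG : (Sx ⊓ K5 ⊓ K3 ⊓ N).relIndex I ∣ 60 := by
    rw [← Subgroup.relIndex_inf_mul_relIndex (Sx ⊓ K5 ⊓ K3) N I,
      ← Subgroup.relIndex_inf_mul_relIndex (Sx ⊓ K5) K3 (N ⊓ I),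
      ← Subgroup.relIndex_inf_mul_relIndex Sx K5 (K3 ⊓ (N ⊓ I))]
    have h := mul_dvd_mul (mul_dvd_mul (mul_dvd_mul hSxr hK5r) hK3r) hN
    simpa using h
  -- `H ⊓ I ⊇ (Sx ⊓ K5 ⊓ K3 ⊓ N) ⊓ I` (as `I ≤ sqrtFixer(−1)`), so `[I : H ∩ I] ∣ 60`
  have hHr : H.relIndex I ∣ 60 := by
    have hle : Sx ⊓ K5 ⊓ K3 ⊓ N ⊓ I ≤ H := by
      intro τ hτ
      refine ⟨⟨hτ.1.1.2, hτ.1.1.1.2⟩, (hIA hτ.2).1, hτ.1.1.1.1⟩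
    have h := Subgroup.relIndex_dvd_of_le_left I hle
    rw [Subgroup.inf_relIndex_right] at h
    exact h.trans hG
  -- (5) `e(w | v)`, read on the inertia group of `Gal(L/F_tpd)`, divides `[I : I ∩ Gal(F̄/L)] ∣ [I : I ∩ H]`
  set Q : Ideal (𝓞 L) := w.asIdeal.map (RingOfIntegers.mapAlgEquiv e : 𝓞 F ≃ₐ[𝓞 P.F] 𝓞 L) with hQ
  haveI : Q.IsPrime := isPrime_map_mapAlgEquiv e w
  haveI : Q.LiesOver v.asIdeal := liesOver_map_mapAlgEquiv e w _
  rw [← ramificationIdx_map_mapAlgEquiv e w]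
  set r : absoluteGaloisGroup P.F →* (L ≃ₐ[P.F] L) := AlgEquiv.restrictNormalHom L with hr
  have hker : r.ker = L.fixingSubgroup := IntermediateField.restrictNormalHom_ker L
  have h1 : (𝔓.comap (ringOfIntegersToIntegralClosure (k := P.F) (Ω := Ω) L)).inertia (L ≃ₐ[P.F] L) ≤
      I.map r := by
    intro g hg
    obtain ⟨σ, hσ, hσg⟩ := @exists_mem_inertia_restrict_eq P.F _ _ L _ _ 𝔓 h𝔓.1 g hg
    refine ⟨σ, hσ, AlgEquiv.ext fun x => Subtype.ext ?_⟩
    change (algebraMap L Ω) ((σ.restrictNormal L) x) = (algebraMap L Ω) (g x)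
    rw [AlgEquiv.restrictNormal_commutes]
    exact hσg x
  have key : Q.ramificationIdx (𝓞 P.F) ∣ 60 := by
    rw [@ramificationIdx_eq_card_inertia_comap P.F _ _ L _ _ v 𝔓 h𝔓.1 h𝔓.2 Q _ _]
    have hdvd : Nat.card ((𝔓.comap (ringOfIntegersToIntegralClosure (k := P.F) (Ω := Ω) L)).inertia
        (L ≃ₐ[P.F] L)) ∣ L.fixingSubgroup.relIndex I := by
      have h := Subgroup.card_dvd_of_le h1
      rwa [← Subgroup.relIndex_ker I r, hker] at h
    exact hdvd.trans ((Subgroup.relIndex_dvd_of_le_left I hHN).trans hHr)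
  exact key

end Cor22

end Literature.IUT.LogVolume

end
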